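import Literature.NumberTheory.Automorphic.Liu2021.Def411WeilCarriersSurvival
import Literature.NumberTheory.Automorphic.Liu2021.Def411IrreducibleOfLemD1AsPrinted
import HarnessLib

/-!
# [Liu2021, Def. 4.11]'s carriers `ω(μ, ε, χ)`, `𝔾(𝔸_F^∞) ↷`, AT A GIVEN REPRESENTATIVE LINE `⟨a⟩` of the collection `ε`

Topic `NumberTheory/Automorphic/Liu2021`; namespace `Literature.NumberTheory.Automorphic.Liu2021.Def411WeilCarriers` (sequel of
`Def411WeilCarriers`, `Def411WeilCarriersSurvival`, `Def411IrreducibleOfLemD1AsPrinted`).  KERNEL ONLY: one structure (`Rep`, data + its faithfulness field), definitions with bodies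
(`Rep.ofLineOf`, `Rep.update`, `omegaAtLine` ∕ `rhoVAtLine` ∕ `rhoAtLine`) and theorems; no `def … : Prop`, no named fact, no `sorry`.  Nothing of [Liu2021] is asserted: Lemma D.1 (1) enters only as the HYPOTHESIS `LemD1_1AsPrinted (…)`.

WHY.  `Def411WeilCarriers.omega … ε χ` realises [Liu2021, Def. 4.11]'s `ω(μ, ε, χ) := ⊗'_v ω(μ_v, ε_v, χ_v)` (a restricted tensor
product of LOCAL oscillator representations over the nonarchimedean places, l. 2092–2096) as the `χ_W`-coinvariants of the finite Weil
representation of the GLOBAL pair `(V, ⟨lineOf ε⟩)`, `lineOf ε` being SOME global representative of the collection `ε` of local norm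
classes (`Def411WeilCarriers.lineOf`, a choice; its docstring: «another representative differs by a global element that is a local norm
everywhere and gives an isomorphic …»).  A consumer that must IDENTIFY `ω(μ, ε, χ)` with a Weil module living on ITS OWN representative
line `⟨a⟩` of the same collection (the Δ2 bridge of the Hodge CM programme: the ported package's index lines sit at prescribed Gram
scalars) needs the same carriers and the same readings AT `⟨a⟩`.  This file provides them, for every unit `a : Fˣ`, over the SAME generic
cores — the `lineOf ε`-versions of the tree are literally the instances `a := lineOf ε` (`omega_eq_omegaAtLine`, `rho_eq_rhoAtLine`, `rfl`):

* §0 `Rep F d` — the FAITHFUL representative sections `r.toFun : Eps F d → Fˣ` (`locF (r ε) = ε` whenever `ε` is global), with `Rep.ofLineOf`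
  (the tree's choice) and `Rep.update r ε₀ a₀ h` (re-point one collection at a prescribed representative `a₀`, `locF a₀ = ε₀`);
* §1 `omegaAtLine hs a χ`, `rhoVAtLine`, `rhoAtLine ι` — the Weil `χ_W`-coinvariants of the pair `(V, ⟨a⟩)` at the splitting `s_a` and
  their `U(J_V)(𝔸_{F,f})` ∕ `𝔾(𝔸_F^∞)`-actions ([Liu2021] Def. 4.11, App. D §D.1 Steps 2–3); `rhoAtLine_smooth` (Def. 4.11 «admissible»:
  smooth vectors, `weilCoinv_comp_smooth`), `rhoVAtLine_finAdelicCenter` (Step 3: central character `χ`);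
* §2 `survival_atLine` — Def. 4.11's `⊗'` survival clause at `⟨a⟩` for EVERY restricted family of local splittings
  (`FinLocalSplittings.exists_finset_mk_unitVec_ne_zero`);
* §3 `rhoAtLine_isIrreducible_of_lemD1AsPrinted` (+ the twist-exposed and `_of_factors` forms) — Def. 4.11's «irreducible» at `⟨a⟩`
  from [Liu2021, App. D Lemma D.1 (1)] AS PRINTED per place for the local datum `localLemD1Data … a 𝓢 … v` (hypothesis `hD1`), the
  survival clause DISCHARGED — the `a`-form of `rho_isIrreducible_of_lemD1AsPrinted'`.

## References

* [Liu2021] Y. Liu, *Fourier–Jacobi cycles and arithmetic relative trace formula*, Camb. J. Math. 9 (2021) = arXiv:2102.11518: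
  Def. 4.11 (l. 2083–2097), Def. 4.12 (l. 2102–2108), App. D §D.1 Steps 1–3 (l. 5214–5221), Lem. D.1 (l. 5226–5233).
* [GelbartRogawski1991] S. Gelbart, J. Rogawski, Invent. Math. 105 (1991), §3.1 Prop. 3.1.1 p. 455 L1–3, Remark p. 457 L4–13.
* [Flath1979] D. Flath, *Decomposition of representations into tensor products*, Corvallis I, Theorem 2 ∕ Example 2.
-/

noncomputable section

open scoped Matrix Kronecker TensorProduct Classical RestrictedProduct
open NumberField NumberField.mixedEmbedding IsDedekindDomain Filter Set
open Literature.NumberTheory Literature.NumberTheory.Automorphic Literature.NumberTheory.Automorphic.UnitaryGroup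
open Literature.NumberTheory.GelbartRogawski1991 Literature.NumberTheory.GelbartRogawski1991.UnitaryDualPair
open Literature.NumberTheory.GelbartRogawski1991.UnitaryDualPair.WeilCoinv
open Literature.NumberTheory.Weil1964 Literature.RepresentationTheory
open Literature.RepresentationTheory.HeisenbergGroup
open Literature.GroupTheory.RestrictedProductCharacter

namespace Literature.NumberTheory.Automorphic.Liu2021.Def411WeilCarriers

/-! ## §0 Faithful representative sections of the collections -/

section RepSection

variable (F : Type) [Field F] [NumberField F] (d : F)

/-- **faithful representative sections** of the collections `ε = (ε_v)_v` of [Liu2021, Def. 4.11]: functions `r : Eps F d → Fˣ` with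
`locF (r ε) = ε` for every GLOBAL collection `ε` (one admitting a representative at all) — `⟨r ε⟩` is then a hermitian line whose local norm
classes are `ε`, as `⟨lineOf ε⟩` is.  Off the global collections `r` is unconstrained (those index no summand of Thm. 4.18: admissible
collections are global, `locF_lineOf_epsOf`). [cite: Liu2021, Def. 4.11 (l. 2088), Def. 4.12 (l. 2102–2108)] -/
structure Rep : Type where
  /-- the representative `r ε ∈ F^×` of the collection `ε` -/
  toFun : Eps F d → Fˣ
  /-- faithfulness on the global collections: `locF (r ε) = ε` -/
  locF_toFun : ∀ ε : Eps F d, (∃ a : Fˣ, locF F d a = ε) → locF F d (toFun ε) = ε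

/-- the tree's choice `lineOf` is a faithful representative section (`locF_lineOf`). [cite: Liu2021, Def. 4.12 (l. 2102–2108)] -/
def Rep.ofLineOf : Rep F d :=
  ⟨lineOf F d, fun _ h => locF_lineOf F d h⟩

/-- `Rep.ofLineOf` is `lineOf`. [cite: Liu2021, Def. 4.12 (l. 2102–2108)] -/
@[simp] theorem Rep.ofLineOf_toFun (ε : Eps F d) : (Rep.ofLineOf F d).toFun ε = lineOf F d ε := rfl

/-- **re-pointing one collection**: the section equal to `r` except at `ε₀`, where it takes the prescribed representative `a₀`
(`locF a₀ = ε₀`). [cite: Liu2021, Def. 4.12 (l. 2102–2108)] -/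
def Rep.update (r : Rep F d) (ε₀ : Eps F d) (a₀ : Fˣ) (h : locF F d a₀ = ε₀) : Rep F d where
  toFun ε := if ε = ε₀ then a₀ else r.toFun ε
  locF_toFun ε hε := by
    by_cases hε₀ : ε = ε₀
    · simp only [hε₀, if_true, h]
    · simp only [hε₀, if_false, r.locF_toFun ε hε]

/-- the re-pointed section takes the value `a₀` at `ε₀`. [cite: Liu2021, Def. 4.12 (l. 2102–2108)] -/
@[simp] theorem Rep.update_toFun_self (r : Rep F d) (ε₀ : Eps F d) (a₀ : Fˣ) (h : locF F d a₀ = ε₀) :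
    (Rep.update F d r ε₀ a₀ h).toFun ε₀ = a₀ := by
  simp [Rep.update]

/-- … and agrees with `r` elsewhere. [cite: Liu2021, Def. 4.12 (l. 2102–2108)] -/
theorem Rep.update_toFun_of_ne (r : Rep F d) (ε₀ : Eps F d) (a₀ : Fˣ) (h : locF F d a₀ = ε₀) {ε : Eps F d}
    (hε : ε ≠ ε₀) : (Rep.update F d r ε₀ a₀ h).toFun ε = r.toFun ε := by
  simp [Rep.update, hε]

end RepSection

section Liu

variable (F E : Type) [Field F] [NumberField F] [Field E] [NumberField E] [Algebra F E]
variable (c : E ≃ₐ[F] E) (N : ℕ) {n : ℕ} (e : Fin N × Fin 1 ≃ Fin n)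
variable (JV : Matrix (Fin N) (Fin N) E) {TV : Matrix (Fin N) (Fin N) F}
variable [Algebra.IsQuadraticExtension F E] {δ : E} (hcδ : c δ = -δ) (hδ : δ ≠ 0) {d : F}
  (hd : δ * δ = algebraMap F E d) (hV : TV.IsSymm) (hVd : IsUnit TV.det) (hJV : JV = TV.map (algebraMap F E))

/-! ## §1 The carriers at the line `⟨a⟩` -/

section Omega

variable {s : ∀ a : Fˣ, UnitaryGroup.adelicPair F E c N 1 JV (JW F E a) →* adelicMpCont F (Fin n) (adelicGram F e TV (TW F a))}
  (hs : ∀ a : Fˣ, (splittingDatum F E c N 1 e JV (JW F E a) hcδ hδ hd hV (isSymm_TW F a) hVd (isUnit_det_TW F a) hJV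
    (JW_eq F E a)).IsCompatible (s a))

/-- **`ω(μ, ε, χ)` realised AT THE LINE `⟨a⟩`** (`a` any representative of the collection `ε`): the `χ_W`-coinvariants of the finite Weil
representation of the finite-adelic dual pair `U(J_V) × U(⟨a⟩)` at the splitting `s_a`, under `U(W)(𝔸_{F,f}) = E¹(𝔸_f)` acting by the line
character `lineChar a χ`.  At `a := lineOf ε` this is `Def411WeilCarriers.omega … ε χ` (`omega_eq_omegaAtLine`).
[cite: Liu2021, Def. 4.11 (l. 2092–2096); App. D §D.1 Step 3 (l. 5221)] -/
abbrev omegaAtLine (a : Fˣ) (χ : Chi F E c) : Type :=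
  TwistedCoinv.Coinv
    (finPairRepW F E c N 1 e JV (JW F E a) hcδ hδ hd hV (isSymm_TW F a) hVd (isUnit_det_TW F a) hJV (JW_eq F E a) (hs a))
    (lineChar F E c a χ.1)

/-- **the `U(J_V)(𝔸_{F,f})`-action on `ω(μ, ε, χ)` at the line `⟨a⟩`** (`WeilCoinv.weilCoinv`).
[cite: Liu2021, Def. 4.11 (l. 2092–2096); App. D §D.1 Steps 2–3 (l. 5217–5221)] -/
def rhoVAtLine (a : Fˣ) (χ : Chi F E c) :
    Representation ℂ (UnitaryGroup.finAdelic F E c N JV) (omegaAtLine F E c N e JV hcδ hδ hd hV hVd hJV hs a χ) :=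
  weilCoinv F E c N 1 e JV (JW F E a) hcδ hδ hd hV (isSymm_TW F a) hVd (isUnit_det_TW F a) hJV (JW_eq F E a)
    (lineChar F E c a χ.1) (hs a)

variable {G : Type*} [Group G] [TopologicalSpace G] (ι : G →* UnitaryGroup.finAdelic F E c N JV)

/-- **the `𝔾(𝔸_F^∞) = G`-action on `ω(μ, ε, χ)` at the line `⟨a⟩`** through the identification `ι : G →* U(J_V)(𝔸_{F,f})`.
[cite: Liu2021, Def. 4.11 (l. 2092–2096); App. C (l. 4624)] -/
def rhoAtLine (a : Fˣ) (χ : Chi F E c) : Representation ℂ G (omegaAtLine F E c N e JV hcδ hδ hd hV hVd hJV hs a χ) :=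
  (rhoVAtLine F E c N e JV hcδ hδ hd hV hVd hJV hs a χ).comp ι

omit [TopologicalSpace G] in
/-- unfolding: `rhoAtLine ι a χ g = rhoVAtLine a χ (ι g)`. [cite: Liu2021, Def. 4.11 (l. 2092–2096)] -/
theorem rhoAtLine_apply (a : Fˣ) (χ : Chi F E c) (g : G) :
    rhoAtLine F E c N e JV hcδ hδ hd hV hVd hJV hs ι a χ g = rhoVAtLine F E c N e JV hcδ hδ hd hV hVd hJV hs a χ (ι g) := rfl

omit [TopologicalSpace G] in
/-- the tree's carrier IS the carrier at the representative `lineOf ε` (definitional). [cite: Liu2021, Def. 4.11 (l. 2092–2096)] -/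
theorem omega_eq_omegaAtLine (ε : Eps F d) (χ : Chi F E c) :
    omega F E c N e JV hcδ hδ hd hV hVd hJV hs ε χ = omegaAtLine F E c N e JV hcδ hδ hd hV hVd hJV hs (lineOf F d ε) χ := rfl

omit [TopologicalSpace G] in
/-- the tree's action IS the action at the representative `lineOf ε` (definitional). [cite: Liu2021, Def. 4.11 (l. 2092–2096)] -/
theorem rho_eq_rhoAtLine (ε : Eps F d) (χ : Chi F E c) :
    rho F E c N e JV hcδ hδ hd hV hVd hJV hs ι ε χ = rhoAtLine F E c N e JV hcδ hδ hd hV hVd hJV hs ι (lineOf F d ε) χ := rfl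

/-- **SMOOTHNESS at the line `⟨a⟩`** ([Liu2021, Def. 4.11] «irreducible admissible»): for `ι` continuous and the pair splitting `s_a`
continuous, every vector of `ω(μ, ε, χ)` is fixed by an open subgroup of `G` (`WeilCoinv.weilCoinv_comp_smooth`).
[cite: Liu2021, Def. 4.11 (l. 2096)] -/
theorem rhoAtLine_smooth (hι : Continuous ι) (hsc : ∀ a : Fˣ, Continuous (pairSplitting F E c N 1 e JV (JW F E a) (s a)))
    (a : Fˣ) (χ : Chi F E c) (v : omegaAtLine F E c N e JV hcδ hδ hd hV hVd hJV hs a χ) :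
    ∃ S : Subgroup G, IsOpen (S : Set G) ∧ ∀ k ∈ S, rhoAtLine F E c N e JV hcδ hδ hd hV hVd hJV hs ι a χ k v = v :=
  weilCoinv_comp_smooth F E c N 1 e JV (JW F E a) hcδ hδ hd hV (isSymm_TW F a) hVd (isUnit_det_TW F a) hJV (JW_eq F E a)
    (lineChar F E c a χ.1) ι hι (hsc a) (hs a) v

omit [TopologicalSpace G] in
/-- **CENTRAL CHARACTER `χ` at the line `⟨a⟩`** ([Liu2021, App. D §D.1 Step 3]): the centre `u·1_V` of `U(J_V)(𝔸_{F,f})` acts by `χ(u)`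
(`WeilCoinv.weilCoinv_finAdelicCenter`, `lineChar_finAdelicCenter`). [cite: Liu2021, App. D §D.1 Step 3 (l. 5221)] -/
theorem rhoVAtLine_finAdelicCenter (a : Fˣ) (χ : Chi F E c) (u : UnitaryGroup.finAdelicOne F E c)
    (x : omegaAtLine F E c N e JV hcδ hδ hd hV hVd hJV hs a χ) :
    rhoVAtLine F E c N e JV hcδ hδ hd hV hVd hJV hs a χ (UnitaryGroup.finAdelicCenter F E c N JV u) x = ((χ.1 u : ℂˣ) : ℂ) • x := by
  rw [rhoVAtLine, weilCoinv_finAdelicCenter, lineChar_finAdelicCenter]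

end Omega

/-! ## §2 The survival clause of Def. 4.11's `⊗'` at the line `⟨a⟩` -/

section Survival

variable (a : Fˣ) (χ : Chi F E c)
  (𝓢 : LocalSplitting.FinLocalSplittings F E c n hcδ hδ hd (gram F e TV (TW F a)) (isSymm_gram F e hV (isSymm_TW F a))
    (reindex_kronecker_eq_gram_map F E e hJV (JW_eq F E a)))

include hVd in
/-- **THE SURVIVAL CLAUSE `hS` OF [Liu2021, Def. 4.11]'s `⊗'` AT THE LINE `⟨a⟩`, AS A THEOREM**: for ANY restricted family `𝓢` of local
splittings of `U(J_V ⊗ (a))(F_v)` and any automorphic character `χ ∈ Chi`, off a finite set of places the class of `1_{𝒪_vⁿ}` in the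
`χ_v`-coinvariants of `ω_v ∘ (u ↦ u · 1_n)` is NON-ZERO (`FinLocalSplittings.exists_finset_mk_unitVec_ne_zero`; the `a := lineOf ε` instance is
`Def411WeilCarriers.survival`). [cite: Liu2021, Def. 4.11 (l. 2090–2096); GelbartRogawski1991, §3.1 Prop. 3.1.1 p. 455 L1–3, (3.1.3) p. 456] -/
theorem survival_atLine [NeZero n] :
    ∃ S₁ : Finset (HeightOneSpectrum (𝓞 F)), ∀ v ∉ S₁,
      TwistedCoinv.mk (show Representation ℂ (UnitaryGroup.localPi E c 1 (JW F E a) v) _ from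
          (𝓢.omegaLoc v).comp (localCenter E c n (Matrix.reindex e e (JV ⊗ₖ JW F E a)) (JW F E a) (JW_apply_ne_zero F E a) v))
        (localCharOfCenter F E c (JW F E a) (JW_apply_ne_zero F E a) χ.1 v) (unitVec F (Fin n) v) ≠ 0 :=
  𝓢.exists_finset_mk_unitVec_ne_zero (JW F E a) (JW_apply_ne_zero F E a) (isUnit_det_gram F e hVd (isUnit_det_TW F a))
    (JW_map_transpose F E c a) χ.2.1

end Survival

/-! ## §3 Def. 4.11's «irreducible» at the line `⟨a⟩`, from Lemma D.1 (1) AS PRINTED per place -/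

section Rho

variable {s : ∀ a : Fˣ, UnitaryGroup.adelicPair F E c N 1 JV (JW F E a) →* adelicMpCont F (Fin n) (adelicGram F e TV (TW F a))}
  (hs : ∀ a : Fˣ, (splittingDatum F E c N 1 e JV (JW F E a) hcδ hδ hd hV (isSymm_TW F a) hVd (isUnit_det_TW F a) hJV
    (JW_eq F E a)).IsCompatible (s a))
variable (a : Fˣ) (χ : Chi F E c)
/- THE LOCAL DATA at the line `⟨a⟩`: local splittings of `U(J_V ⊗ (a))(F_v)` (Liu's `ι_{μ_v}` for `V_{ε_v}`). -/
variable (𝓢 : LocalSplitting.FinLocalSplittings F E c n hcδ hδ hd (gram F e TV (TW F a)) (isSymm_gram F e hV (isSymm_TW F a))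
    (reindex_kronecker_eq_gram_map F E e hJV (JW_eq F E a)))
variable {G : Type*} [Group G] {ι : G →* UnitaryGroup.finAdelic F E c N JV} (hι : Function.Surjective ι)
/- THE TWIST, exposed: `pairSmall₁ s_a ∘ finPairToAdelic = localRefSection 𝓢 ⊗ χtw`, a factorisation `χ_W = χtw(1, ·) · χ''`
   of the line character, and the character `χ₁ = χ'' ∘ (u ↦ u·1_W)` of the centre. -/
variable {χtw : UnitaryGroup.finAdelic F E c N JV × UnitaryGroup.finAdelic F E c 1 (JW F E a) →* ℂˣ}
  (hχtw : (pairSmall₁ F E c N 1 e JV (JW F E a) (s a)).comp (finPairToAdelic F E c N 1 JV (JW F E a)) =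
    adelicMpCont.twist F (Fin N × Fin 1) _ (localRefSection F E c N 1 e JV (JW F E a) hcδ hδ hd hV (isSymm_TW F a) hJV
      (JW_eq F E a) 𝓢) χtw)
  {χ'' : UnitaryGroup.finAdelic F E c 1 (JW F E a) →* ℂˣ} (hχ'' : ∀ u, lineChar F E c a χ.1 u = χtw (1, u) * χ'' u)
  {χ₁ : UnitaryGroup.finAdelicOne F E c →* ℂˣ} (hχ₁ : χ''.comp (UnitaryGroup.finAdelicCenter F E c 1 (JW F E a)) = χ₁)

include hι hχtw hχ'' hχ₁ in
/-- **`hirr` at the line `⟨a⟩` from the place-assembled Weil representation, the twist GIVEN**: `ι` onto, `χtw` the twist of `s_a` against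
the local reference section of `𝓢`, `χ_W = χtw(1, ·) · χ''`, `χ₁ = χ'' ∘ (u ↦ u·1_W)`; IF the `U(J_V)(𝔸_{F,f})`-action on the maximal quotient of
`Ω = ⊗'_v ω_v` where the centre acts by `χ₁` is irreducible, THEN `rhoAtLine … ι a χ` is irreducible (`isIrreducible_weilCoinv_iff_omega_center`).
[cite: Liu2021, Def. 4.11 (l. 2092–2096), App. D §D.1 Step 3 (l. 5221); GelbartRogawski1991, §3.1 Remark p. 457 L4–13] -/
theorem rhoAtLine_isIrreducible_of_omega_center_of_twist
    (hirrΩ : (TwistedCoinv.rep χ₁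
        (show Representation ℂ (UnitaryGroup.finAdelic F E c N JV) _ from
          𝓢.Omega.comp ((finPairEmb F E c N 1 e JV (JW F E a)).comp (MonoidHom.inl _ _)))
        (commute_omega_finPairEmb_finAdelicCenter F E c N e JV (JW F E a) hcδ hδ hd hV (isSymm_TW F a) hJV (JW_eq F E a)
          𝓢)).IsIrreducible) :
    (rhoAtLine F E c N e JV hcδ hδ hd hV hVd hJV hs ι a χ).IsIrreducible := by
  subst hχ₁
  refine (Representation.isIrreducible_comp_iff_of_surjective _ ι hι).2 ?_
  exact (isIrreducible_weilCoinv_iff_omega_center F E c N e JV (JW F E a) hcδ hδ hd hV (isSymm_TW F a) hVd (isUnit_det_TW F a)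
    hJV (JW_eq F E a) 𝓢 (hs a) hχtw hχ'' (JW_apply_ne_zero F E a)).2 hirrΩ

include hι hχtw hχ'' hχ₁ in
/-- **`hirr` at the line `⟨a⟩` from local inputs at ONE character**: under the twist data, IF `χ₁` is continuous, every local central
quotient of `ω_v = 𝓢.omegaLoc v` at `χ_{1,v}` is irreducible and admissible, and the class of `1_{𝒪_vⁿ}` at `χ_{1,v}` survives off a finite set,
THEN `rhoAtLine … ι a χ` is irreducible (`omega_center_isIrreducible_of_local`, [Flath1979]).
[cite: Liu2021, Def. 4.11 (l. 2092–2096), App. D §D.1 Steps 1∕2∕3 (l. 5217∕5219∕5221), Lemma D.1 (l. 5227); Flath1979, Theorem 2 / Example 2] -/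
theorem rhoAtLine_isIrreducible_of_lemD1_local_of_twist (hχ₁c : Continuous χ₁)
    (hloc : ∀ v,
      (TwistedCoinv.rep (localCharOfCenter F E c (JW F E a) (JW_apply_ne_zero F E a) χ₁ v) (𝓢.omegaLoc v)
          (commute_omegaLoc_localCenter F E c N e JV (JW F E a) hcδ hδ hd hV (isSymm_TW F a) hJV (JW_eq F E a)
            (JW_apply_ne_zero F E a) 𝓢 v)).IsIrreducible ∧
        (TwistedCoinv.rep (localCharOfCenter F E c (JW F E a) (JW_apply_ne_zero F E a) χ₁ v) (𝓢.omegaLoc v)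
          (commute_omegaLoc_localCenter F E c N e JV (JW F E a) hcδ hδ hd hV (isSymm_TW F a) hJV (JW_eq F E a)
            (JW_apply_ne_zero F E a) 𝓢 v)).IsAdmissible)
    (hS : ∃ S₁ : Finset (HeightOneSpectrum (𝓞 F)), ∀ v ∉ S₁,
      TwistedCoinv.mk (show Representation ℂ (UnitaryGroup.localPi E c 1 (JW F E a) v) _ from
          (𝓢.omegaLoc v).comp (localCenter E c n (Matrix.reindex e e (JV ⊗ₖ JW F E a)) (JW F E a) (JW_apply_ne_zero F E a) v))
        (localCharOfCenter F E c (JW F E a) (JW_apply_ne_zero F E a) χ₁ v) (unitVec F (Fin n) v) ≠ 0) :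
    (rhoAtLine F E c N e JV hcδ hδ hd hV hVd hJV hs ι a χ).IsIrreducible := by
  obtain ⟨S₁, hS₁⟩ := hS
  exact rhoAtLine_isIrreducible_of_omega_center_of_twist F E c N e JV hcδ hδ hd hV hVd hJV hs a χ 𝓢 hι hχtw hχ'' hχ₁
    (omega_center_isIrreducible_of_local F E c N e JV (JW F E a) hcδ hδ hd hV (isSymm_TW F a) hJV (JW_eq F E a)
      (JW_apply_ne_zero F E a) 𝓢 hχ₁c hS₁ (fun v => (hloc v).1) (fun v => (hloc v).2))

include hι hχtw hχ'' hχ₁ in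
/-- **Def. 4.11's «irreducible» at the line `⟨a⟩` from LEMMA D.1 (1) AS PRINTED, place by place, the twist exposed**: with `χ₁` continuous and
unitary and Step 2's `μ_v` (unitary, continuous, `μ_v|_{F_vˣ}` with kernel the norms), IF [Liu2021, App. D Lemma D.1, first sentence + (1)] holds
AS PRINTED for `localLemD1Data … a 𝓢 … χ₁ … v` at every finite `v` (hypothesis `hD1 v`), the class of `1_{𝒪_vⁿ}` at `χ_{1,v}` survives off a
finite set, and `n ≥ 3`, THEN `rhoAtLine … ι a χ` is irreducible (junction `LemD1OfPlace.isIrreducible_rep_of_lemD1_1AsPrinted` ∕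
`isAdmissible_rep_of_lemD1_1AsPrinted` at `ω = 𝓢.omegaLoc v`).
[cite: Liu2021, Def. 4.11 (l. 2092–2096), App. D §D.1 Steps 1∕2∕3 (l. 5217∕5219∕5221), Lemma D.1 (l. 5227; (1) l. 5229); Flath1979, Theorem 2 / Example 2] -/
theorem rhoAtLine_isIrreducible_of_lemD1AsPrinted_of_twist (hχ₁c : Continuous χ₁) (hχ₁n : ∀ u, ‖((χ₁ u : ℂˣ) : ℂ)‖ = 1)
    (hn : 3 ≤ n)
    (μ : ∀ v : HeightOneSpectrum (𝓞 F), (LocalRing E v)ˣ →* ℂˣ) (hμn : ∀ v x, ‖((μ v x : ℂˣ) : ℂ)‖ = 1)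
    (hμc : ∀ v, Continuous fun x => ((μ v x : ℂˣ) : ℂ))
    (hμF : ∀ (v : HeightOneSpectrum (𝓞 F)) (t : (v.adicCompletion F)ˣ),
      μ v (Units.map (algebraMap (v.adicCompletion F) (LocalRing E v)).toMonoidHom t) = 1 ↔
        ∃ x : (LocalRing E v)ˣ, (x : LocalRing E v) * conjLocal E c v x =
          algebraMap (v.adicCompletion F) (LocalRing E v) t)
    (hD1 : ∀ v, LemD1_1AsPrinted
      (localLemD1Data F E c N e JV hcδ hδ hd hV hVd hJV a 𝓢 hn μ hμn hμc hμF χ₁ hχ₁n hχ₁c v))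
    (hS : ∃ S₁ : Finset (HeightOneSpectrum (𝓞 F)), ∀ v ∉ S₁,
      TwistedCoinv.mk (show Representation ℂ (UnitaryGroup.localPi E c 1 (JW F E a) v) _ from
          (𝓢.omegaLoc v).comp (localCenter E c n (Matrix.reindex e e (JV ⊗ₖ JW F E a)) (JW F E a) (JW_apply_ne_zero F E a) v))
        (localCharOfCenter F E c (JW F E a) (JW_apply_ne_zero F E a) χ₁ v) (unitVec F (Fin n) v) ≠ 0) :
    (rhoAtLine F E c N e JV hcδ hδ hd hV hVd hJV hs ι a χ).IsIrreducible :=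
  rhoAtLine_isIrreducible_of_lemD1_local_of_twist F E c N e JV hcδ hδ hd hV hVd hJV hs a χ 𝓢 hι hχtw hχ'' hχ₁ hχ₁c
    (fun v =>
      ⟨LemD1OfPlace.isIrreducible_rep_of_lemD1_1AsPrinted E v c n (Matrix.reindex e e (JV ⊗ₖ JW F E a))
          hcδ hδ (Nat.le_of_succ_le hn) (reindex_kronecker_JW_hermitian F E c N e JV hV hJV a)
          (det_reindex_kronecker_JW_ne_zero F E N e JV hVd hJV a) (JW F E a) (𝓢.omegaLoc v) (μ v) (hμn v)
          (hμc v) (hμF v) (localCharOfCenter F E c (JW F E a) (JW_apply_ne_zero F E a) χ₁ v)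
          (norm_localCharOfCenter F E c (JW F E a) (JW_apply_ne_zero F E a) hχ₁n v)
          (continuous_coe_localCharOfCenter F E c (JW F E a) (JW_apply_ne_zero F E a) hχ₁c v)
          (JW_apply_ne_zero F E a)
          (commute_omegaLoc_localCenter F E c N e JV (JW F E a) hcδ hδ hd hV (isSymm_TW F a) hJV
            (JW_eq F E a) (JW_apply_ne_zero F E a) 𝓢 v)
          (hD1 v) hn,
        LemD1OfPlace.isAdmissible_rep_of_lemD1_1AsPrinted E v c n (Matrix.reindex e e (JV ⊗ₖ JW F E a))
          hcδ hδ (Nat.le_of_succ_le hn) (reindex_kronecker_JW_hermitian F E c N e JV hV hJV a)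
          (det_reindex_kronecker_JW_ne_zero F E N e JV hVd hJV a) (JW F E a) (𝓢.omegaLoc v) (μ v) (hμn v)
          (hμc v) (hμF v) (localCharOfCenter F E c (JW F E a) (JW_apply_ne_zero F E a) χ₁ v)
          (norm_localCharOfCenter F E c (JW F E a) (JW_apply_ne_zero F E a) hχ₁n v)
          (continuous_coe_localCharOfCenter F E c (JW F E a) (JW_apply_ne_zero F E a) hχ₁c v)
          (JW_apply_ne_zero F E a)
          (commute_omegaLoc_localCenter F E c N e JV (JW F E a) hcδ hδ hd hV (isSymm_TW F a) hJV
            (JW_eq F E a) (JW_apply_ne_zero F E a) 𝓢 v)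
          (hD1 v)⟩)
    hS

include hι in
/-- **Def. 4.11's «irreducible» at the line `⟨a⟩` when the splitting `s_a` FACTORS through the local reference section** (`χtw = 1`,
hypothesis `hfac`; `χ` unitary as a hypothesis `hχn`).
[cite: Liu2021, Def. 4.11 (l. 2090–2096), App. D §D.1 Steps 1∕2∕3 (l. 5217∕5219∕5221), Lemma D.1 (l. 5227; (1) l. 5229); GelbartRogawski1991, §3.1 Prop. 3.1.1 p. 455 L1–3] -/
theorem rhoAtLine_isIrreducible_of_lemD1AsPrinted_of_factors
    (hfac : (pairSmall₁ F E c N 1 e JV (JW F E a) (s a)).comp (finPairToAdelic F E c N 1 JV (JW F E a)) =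
      localRefSection F E c N 1 e JV (JW F E a) hcδ hδ hd hV (isSymm_TW F a) hJV (JW_eq F E a) 𝓢)
    (hχn : ∀ u, ‖((χ.1 u : ℂˣ) : ℂ)‖ = 1) (hn : 3 ≤ n)
    (μ : ∀ v : HeightOneSpectrum (𝓞 F), (LocalRing E v)ˣ →* ℂˣ) (hμn : ∀ v x, ‖((μ v x : ℂˣ) : ℂ)‖ = 1)
    (hμc : ∀ v, Continuous fun x => ((μ v x : ℂˣ) : ℂ))
    (hμF : ∀ (v : HeightOneSpectrum (𝓞 F)) (t : (v.adicCompletion F)ˣ),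
      μ v (Units.map (algebraMap (v.adicCompletion F) (LocalRing E v)).toMonoidHom t) = 1 ↔
        ∃ x : (LocalRing E v)ˣ, (x : LocalRing E v) * conjLocal E c v x =
          algebraMap (v.adicCompletion F) (LocalRing E v) t)
    (hD1 : ∀ v, LemD1_1AsPrinted
      (localLemD1Data F E c N e JV hcδ hδ hd hV hVd hJV a 𝓢 hn μ hμn hμc hμF χ.1 hχn χ.2.1 v))
    (hS : ∃ S₁ : Finset (HeightOneSpectrum (𝓞 F)), ∀ v ∉ S₁,
      TwistedCoinv.mk (show Representation ℂ (UnitaryGroup.localPi E c 1 (JW F E a) v) _ from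
          (𝓢.omegaLoc v).comp (localCenter E c n (Matrix.reindex e e (JV ⊗ₖ JW F E a)) (JW F E a) (JW_apply_ne_zero F E a) v))
        (localCharOfCenter F E c (JW F E a) (JW_apply_ne_zero F E a) χ.1 v) (unitVec F (Fin n) v) ≠ 0) :
    (rhoAtLine F E c N e JV hcδ hδ hd hV hVd hJV hs ι a χ).IsIrreducible :=
  rhoAtLine_isIrreducible_of_lemD1AsPrinted_of_twist F E c N e JV hcδ hδ hd hV hVd hJV hs a χ 𝓢 hι (χtw := 1)
    (hfac.trans (MonoidHom.ext fun h => (adelicMpCont.twist_eq_of_eq_one _ (1 : _ →* ℂˣ) rfl).symm))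
    (χ'' := lineChar F E c a χ.1) (fun u => by rw [MonoidHom.one_apply, one_mul])
    (MonoidHom.ext (lineChar_finAdelicCenter F E c a χ.1)) χ.2.1 hχn hn μ hμn hμc hμF hD1 hS

include hι hVd in
/-- **Def. 4.11's «irreducible» for `ω(μ, ε, χ)` AT THE LINE `⟨a⟩`, from LEMMA D.1 (1) AS PRINTED, with NO unitarity and NO survival
binder** — the `a`-form of `rho_isIrreducible_of_lemD1AsPrinted'`: for `ι` onto, the local–global factorisation `hfac` of `s_a` through the
local splittings `𝓢` (DATA), Step 2's characters `μ_v`, `3 ≤ n`, and the per-place AS-PRINTED cite `hD1 v : LemD1_1AsPrinted (localLemD1Data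
… a 𝓢 … χ … v)` ⟹ `rhoAtLine … ι a χ` irreducible; unitarity of `χ` is `norm_chi_eq_one`, survival is `survival_atLine`.  Nothing of
[Liu2021] is asserted. [cite: Liu2021, Def. 4.11 (l. 2090–2096), App. D §D.1 Steps 1∕2∕3 (l. 5217∕5219∕5221), Lemma D.1 (l. 5227; (1) l. 5229); GelbartRogawski1991, §3.1 Prop. 3.1.1 p. 455 L1–3; Godement1964, §5 Thm. 4] -/
theorem rhoAtLine_isIrreducible_of_lemD1AsPrinted
    (hfac : (pairSmall₁ F E c N 1 e JV (JW F E a) (s a)).comp (finPairToAdelic F E c N 1 JV (JW F E a)) =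
      localRefSection F E c N 1 e JV (JW F E a) hcδ hδ hd hV (isSymm_TW F a) hJV (JW_eq F E a) 𝓢)
    (hn : 3 ≤ n)
    (μ : ∀ v : HeightOneSpectrum (𝓞 F), (LocalRing E v)ˣ →* ℂˣ) (hμn : ∀ v x, ‖((μ v x : ℂˣ) : ℂ)‖ = 1)
    (hμc : ∀ v, Continuous fun x => ((μ v x : ℂˣ) : ℂ))
    (hμF : ∀ (v : HeightOneSpectrum (𝓞 F)) (t : (v.adicCompletion F)ˣ),
      μ v (Units.map (algebraMap (v.adicCompletion F) (LocalRing E v)).toMonoidHom t) = 1 ↔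
        ∃ x : (LocalRing E v)ˣ, (x : LocalRing E v) * conjLocal E c v x =
          algebraMap (v.adicCompletion F) (LocalRing E v) t)
    (hD1 : ∀ v, LemD1_1AsPrinted
      (localLemD1Data F E c N e JV hcδ hδ hd hV hVd hJV a 𝓢 hn μ hμn hμc hμF χ.1
        (norm_chi_eq_one F E c (Algebra.IsQuadraticExtension.finrank_eq_two F E)
          (UnitaryGroup.algEquiv_ne_one_of_apply_eq_neg F E c hcδ hδ) χ) χ.2.1 v)) :
    (rhoAtLine F E c N e JV hcδ hδ hd hV hVd hJV hs ι a χ).IsIrreducible :=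
  haveI : NeZero n := ⟨by omega⟩
  rhoAtLine_isIrreducible_of_lemD1AsPrinted_of_factors F E c N e JV hcδ hδ hd hV hVd hJV hs a χ 𝓢 hι hfac
    (norm_chi_eq_one F E c (Algebra.IsQuadraticExtension.finrank_eq_two F E)
      (UnitaryGroup.algEquiv_ne_one_of_apply_eq_neg F E c hcδ hδ) χ) hn μ hμn hμc hμF hD1
    (survival_atLine F E c N e JV hcδ hδ hd hV hVd hJV a χ 𝓢)

end Rho

end Liu

end Literature.NumberTheory.Automorphic.Liu2021.Def411WeilCarriers

end
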